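/-
Copyright (c) 2026 the pub-hodgecm-mathlib formalisation cell (harness21).  Prover seat hodgecm-mathlib-K2E3-p04 (g0), Track B ∕ K2-LIT
(build stream 29), h413 = `stmt-HodgeConjecture-24833`, line `K2_E3_EllipticInputs`, unit U4 «Keys» — DEAL `K2E3RankOneIntertwiningIntegral`, road I, brick I-3b
«HEIGHT-BALL VOLUME SCALING ON `N(L⁺_v)`».  2026-09-04.
-/
import Summits.HodgeConjecture.HodgeConjecture.Theorems.K2E3IntertwiningIntegralShellBound    -- ★ (this seat, p855288): `measure_ball_pow_eq` (generic: `μ(B_{AQ^k}) = κ⁻ᵏ μ(B_A)`)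
import Summits.HodgeConjecture.HodgeConjecture.Theorems.K2E3IntertwiningIntegralMajorant     -- ★ (this seat, p855338): `height_torusConj` (`m(t⁻¹ut) = ‖d₀‖⁻² m(u)`), `measure_normBall_lt_top`; brings ★ T2, ★ DICT
import Summits.HodgeConjecture.HodgeConjecture.Theorems.F0P3cStCharTSTorusDefs               -- ★ `torusChart` (`d(α, ·, σ(α)⁻¹) ∈ T`), `coe_torusChart`
import HarnessLib

/-!
# h413 ∕ Track B «K2-LIT», unit U4 «Keys», DEAL `K2E3RankOneIntertwiningIntegral`, road I brick I-3b: the HEIGHT BALLS `B_A = {u ∈ N(L⁺_v) : ‖u₀₂‖ ≤ A}` scale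
# under `Ad(t⁻¹)`, `t = d(α, 1, σ(α)⁻¹)`: `μ(B_{A·‖α‖⁻²ᵏ}) = ‖α‖⁻²ᵏ · μ(B_A)` for every Haar measure `μ` of `N(L⁺_v)`, every unit `α`, every finite `v`
# — the EVEN-STEP RECURSION of the shell volumes in Harish-Chandra's `c_w(χ) = μ(B₁) + Σ_k (z∕q)^k μ(S_k)`  [Casselman1995 §6.4; WeilBNT1967 II §5; Rogawski1990 §4.5]

Cell `pub/hodgecm-mathlib`, crux H413 = `stmt-HodgeConjecture-24833` (lane `--supports … --as helper`), route HCCMUnconditional; dealer K2E3-plan (g1) («Road I files stay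
`--supports 24833 --as helper`», 2026-09-03T23:02Z); MEMO `K2/K2E3-p04/g0/MEMO-ROAD-I-intertwining-integral.K2E3-p04-g0.md` §3 (this is the first file named there).
THEOREMS ONLY (0 def ∕ 0 instance ∕ 0 notation ∕ 0 sorry); ★-only imports.

THE MATHEMATICS.  On `N(L⁺_v)` with height `m(u) = Π_w |(u₀₂)_w|_w` (★ norm balls of `F0P3cStCharTSKeys3AnnulusDock`): for `t = torusChart(α, 1) ∈ T`
(★ `F0P3cStCharTSTorusDefs`), `c = Ad(t⁻¹)` (★ `HeisRing.torusConj t`) multiplies the height by `Q = ‖α‖⁻²` (★ `height_torusConj`) and Haar measure by `κ = Δ_B(t) = ‖α‖²`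
(★ T2 `map_torusConj_cmBorel_eq_modularCharacter_nnreal_smul`, ★ `modularCharacter_cmBorel_torus`); ★ `measure_ball_pow_eq` turns this into
**`μ {m ≤ A · (‖α‖⁻²)^k} = (‖α‖²)⁻ᵏ · μ {m ≤ A}`** (§1 `measure_heightBall_scaling`), for EVERY unit `α` (no size condition), every `A`, every `k`, every finite `v` (split or not).
At a uniformiser (`‖ϖ‖ = q_w⁻¹`) this is `μ(B_{A q_w^{2k}}) = q_w^{2k} μ(B_A)`: consecutive EVEN shells of `c_w(χ)` differ by the factor `q_w²` — so the closed form of `c_w` needs only the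
two base volumes `μ(S₁)∕μ(B₁)`, `μ(S₂)∕μ(B₁)` (MEMO §2).  `measure_heightBall_lt_top` records the finiteness of every ball at a non-split `v` in the same currency.

HONEST LABEL.  HC_CM is proved only modulo the 7 printed citations (2 remaining named inputs: hLiu418 = `stmt-HodgeConjecture-24832`, h413 = `stmt-HodgeConjecture-24833`) until
rung 0 closes; count-neutral.

## References
* [Casselman1995] W. Casselman, *Introduction to the theory of admissible representations of `p`-adic reductive groups* (1995), §6.4 pp. 62–64.
* [WeilBNT1967] A. Weil, *Basic Number Theory* (1967), Ch. II §5 Prop. 12 (modules and scaling of Haar measures).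
* [Rogawski1990] J. D. Rogawski, *Automorphic Representations of Unitary Groups in Three Variables* (1990), §1.10 p. 9, §4.5 p. 45.
-/

set_option autoImplicit false
-- the mandated namespace repeats the single-problem summit's segment (`HodgeConjecture.HodgeConjecture`)
set_option linter.dupNamespace false

noncomputable section

open NumberField IsDedekindDomain MeasureTheory
open scoped Matrix NNReal ENNReal

open Literature.NumberTheory Literature.NumberTheory.Automorphic Literature.NumberTheory.Automorphic.UnitaryGroup
open Literature.NumberTheory.GaloisRepresentations Literature.NumberTheory.GaloisRepresentations.IsNonarchimedeanLocalField

namespace Summit.HodgeConjecture.HodgeConjecture.Cruxes.H413.K2E3HeightBallVolumeScaling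

variable (L : Type) [Field L] [NumberField L] [IsCMField L] (v : HeightOneSpectrum (𝓞 ↥(maximalRealSubfield L)))

/-! ## §1 `μ(B_{A‖α‖⁻²ᵏ}) = ‖α‖⁻²ᵏ μ(B_A)` -/

set_option synthInstance.maxHeartbeats 400000 in
set_option maxHeartbeats 4000000 in
-- the torus-conjugation ∕ Jacobian bookkeeping on the matrix carrier (class of ★ `K2E3RankOneIntertwiningIntegralConvergence.integrable_cellFun`)
/-- **HEIGHT-BALL VOLUME SCALING.**  For every finite place `v`, every unit `α` of `Π_{w ∣ v} L_w`, every Haar measure `μ` of `N(L⁺_v)`, every `A : ℝ` and `k : ℕ`: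
`μ {u : ‖u₀₂‖ ≤ A · (‖α‖⁻²)^k} = ((‖α‖²)⁻¹)^k · μ {u : ‖u₀₂‖ ≤ A}` — ★ `measure_ball_pow_eq` with `c = Ad(t⁻¹)`, `t = torusChart(α, 1)`, height factor `Q = ‖α‖⁻²` (★ `height_torusConj`), Jacobian
`κ = Δ_B(t) = ‖α‖²` (★ T2 + ★ `modularCharacter_cmBorel_torus`), `κ⁻¹ = Q`. [cite: WeilBNT1967, Ch. II §5 Prop. 12] [cite: Casselman1995, §6.4 p. 63] [cite: Rogawski1990, §1.10 p. 9] -/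
theorem measure_heightBall_scaling (α : (LocalRing L v)ˣ)
    [MeasurableSpace ↥(cmBorelTriple L 3 v).N] [BorelSpace ↥(cmBorelTriple L 3 v).N] (μ : Measure ↥(cmBorelTriple L 3 v).N) [μ.IsHaarMeasure] (A : ℝ) (k : ℕ) :
    μ {u : ↥(cmBorelTriple L 3 v).N | (((∏ w' : PlacesOver L v, normAbs (w'.1.adicCompletion L) ((((((u : ↥(unitaryGroupOfForm (conjLocal L (IsCMField.complexConj L) v) (cmLocalForm L 3 v)))) : GL (Fin 3) (LocalRing L v)) : Matrix (Fin 3) (Fin 3) (LocalRing L v)) 0 2) w')) : ℝ≥0) : ℝ) ≤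
        A * ((((unitModulusChar (LocalRing L v) α : ℝ≥0) : ℝ) * ((unitModulusChar (LocalRing L v) α : ℝ≥0) : ℝ))⁻¹) ^ k} =
      ((ENNReal.ofNNReal (unitModulusChar (LocalRing L v) α * unitModulusChar (LocalRing L v) α))⁻¹) ^ k *
        μ {u : ↥(cmBorelTriple L 3 v).N | (((∏ w' : PlacesOver L v, normAbs (w'.1.adicCompletion L) ((((((u : ↥(unitaryGroupOfForm (conjLocal L (IsCMField.complexConj L) v) (cmLocalForm L 3 v)))) : GL (Fin 3) (LocalRing L v)) : Matrix (Fin 3) (Fin 3) (LocalRing L v)) 0 2) w')) : ℝ≥0) : ℝ) ≤ A} := by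
  haveI := locallyCompactSpace_cmBorelU L 3 v
  letI : MeasurableSpace (LocalRing L v) := borel _
  haveI : BorelSpace (LocalRing L v) := ⟨rfl⟩
  set t : ↥(cmBorelTriple L 3 v).M := F0P3cStCharTSTorusDefs.torusChart L v (α, 1) with ht
  have hd : glDiagonal 3 (LocalRing L v) (F0P3cStCharTSTorusDefs.torusChartEntries L v (α, 1)) = ((t : ↥(unitaryGroupOfForm (conjLocal L (IsCMField.complexConj L) v) (cmLocalForm L 3 v))) : GL (Fin 3) (LocalRing L v)) :=
    (F0P3cStCharTSTorusDefs.coe_torusChart L v (α, 1)).symm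
  have hd0 : F0P3cStCharTSTorusDefs.torusChartEntries L v (α, 1) 0 = α := rfl
  set a : ℝ := ((unitModulusChar (LocalRing L v) α : ℝ≥0) : ℝ) with ha
  have ha0 : 0 < a := NNReal.coe_pos.2 distribHaarChar_pos
  have hA : 0 < a * a := mul_pos ha0 ha0
  have hm : Measurable fun u : ↥(cmBorelTriple L 3 v).N => (((∏ w' : PlacesOver L v, normAbs (w'.1.adicCompletion L) ((((((u : ↥(unitaryGroupOfForm (conjLocal L (IsCMField.complexConj L) v) (cmLocalForm L 3 v)))) : GL (Fin 3) (LocalRing L v)) : Matrix (Fin 3) (Fin 3) (LocalRing L v)) 0 2) w')) : ℝ≥0) : ℝ) := (F0P3cStCharTSKeys3AnnulusDock.continuous_norm_entry L v).measurable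
  have hc : Measurable (HeisRing.torusConj (conjLocal L (IsCMField.complexConj L) v) t) :=
    (HeisRing.continuous_torusConj (conjLocal L (IsCMField.complexConj L) v) t).measurable
  have hκ := map_torusConj_cmBorel_eq_modularCharacter_nnreal_smul L v t μ
  have hκval : (Measure.modularCharacter (⟨(t : ↥(unitaryGroupOfForm (conjLocal L (IsCMField.complexConj L) v) (cmLocalForm L 3 v))), torusU_le_borelU _ _ t.2⟩ : ↥(cmBorelTriple L 3 v).P) : ℝ≥0) =
      unitModulusChar (LocalRing L v) α * unitModulusChar (LocalRing L v) α := by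
    rw [F0P2oBorelTorusModulus.modularCharacter_cmBorel_torus L v t hd, hd0]
  have hκ0 : (Measure.modularCharacter (⟨(t : ↥(unitaryGroupOfForm (conjLocal L (IsCMField.complexConj L) v) (cmLocalForm L 3 v))), torusU_le_borelU _ _ t.2⟩ : ↥(cmBorelTriple L 3 v).P) : ℝ≥0) ≠ 0 := by
    rw [hκval]; exact (mul_pos distribHaarChar_pos distribHaarChar_pos).ne'
  have hmc : ∀ u : ↥(cmBorelTriple L 3 v).N, (((∏ w' : PlacesOver L v, normAbs (w'.1.adicCompletion L) (((((((HeisRing.torusConj (conjLocal L (IsCMField.complexConj L) v) t u : ↥(cmBorelTriple L 3 v).N) : ↥(unitaryGroupOfForm (conjLocal L (IsCMField.complexConj L) v) (cmLocalForm L 3 v)))) : GL (Fin 3) (LocalRing L v)) : Matrix (Fin 3) (Fin 3) (LocalRing L v)) 0 2) w')) : ℝ≥0) : ℝ) = (a * a)⁻¹ * (((∏ w' : PlacesOver L v, normAbs (w'.1.adicCompletion L) ((((((u : ↥(unitaryGroupOfForm (conjLocal L (IsCMField.complexConj L) v) (cmLocalForm L 3 v)))) : GL (Fin 3) (LocalRing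 L v)) : Matrix (Fin 3) (Fin 3) (LocalRing L v)) 0 2) w')) : ℝ≥0) : ℝ) := by
    intro u
    rw [K2E3IntertwiningIntegralMajorant.height_torusConj L v t hd u, hd0, NNReal.coe_mul, NNReal.coe_mul, NNReal.coe_inv, ha, mul_inv]
    rfl
  have hQ : 0 < (a * a)⁻¹ := inv_pos.2 hA
  have h := K2E3IntertwiningIntegralShellBound.measure_ball_pow_eq μ hm hc hκ hQ hmc hκ0 A k
  rw [hκval] at h
  exact h

/-- **Every height ball has finite Haar measure** at a non-split `v` (★ `measure_normBall_lt_top`: `B_A` is compact), recorded in the currency of §1. [cite: Casselman1995, §6.3] -/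
theorem measure_heightBall_lt_top (hns : ∀ w : PlacesOver L v, IsCMField.complexConj L • w.1 = w.1)
    [MeasurableSpace ↥(cmBorelTriple L 3 v).N] (μ : Measure ↥(cmBorelTriple L 3 v).N) [IsFiniteMeasureOnCompacts μ] (A : ℝ) :
    μ {u : ↥(cmBorelTriple L 3 v).N | (((∏ w' : PlacesOver L v, normAbs (w'.1.adicCompletion L) ((((((u : ↥(unitaryGroupOfForm (conjLocal L (IsCMField.complexConj L) v) (cmLocalForm L 3 v)))) : GL (Fin 3) (LocalRing L v)) : Matrix (Fin 3) (Fin 3) (LocalRing L v)) 0 2) w')) : ℝ≥0) : ℝ) ≤ A} < ∞ :=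
  K2E3IntertwiningIntegralMajorant.measure_normBall_lt_top L v hns μ A

end Summit.HodgeConjecture.HodgeConjecture.Cruxes.H413.K2E3HeightBallVolumeScaling

end
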